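import Summits.MatrixMultiplication.MatrixMultiplication.Theorems.GradedDesignFamily.Negative.SubfieldCellNineRowTwoAny
import Summits.MatrixMultiplication.MatrixMultiplication.Theorems.GradedDesignFamily.Negative.CuspFormWall

/-!
# Subfield cell `GL₂(𝔽₉) ⊃ SL₂(𝔽₃)` at level one — VI: the exact counting wall `|Y| + |Z| ≤ 20`

**Honest framing.** VALUE = a kernel-checked bound for ONE finite cell (`|k| = 3`, `|K| = 9`) of
ONE skeleton line (`quadratic_extension_level_one_cell`, stub S3 `stub_subfieldCell`, crux
`GradedDesignFamily`, route `LevelGradedCohnUmans`).  It is **not** summit progress (no bound on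
`ω`), and does **not** bear on the asymptotic stub.

## The theorem

`subfieldCell_nine_wall_twenty`: for all `(k, K, φ)` with `|k| = 3`, `|K| = |k|²`,
`φ : SL₂(k) ↪ GL₂(K)`, and nonempty `Y, Z` satisfying S3's clause verbatim: `|Y| + |Z| ≤ 20`
(hence `|Y|·|Z| ≤ 100`, `subfieldCell_nine_area_le`).  This is the wall (V2) of SUBFIELD.md §2
(`(|Y|+|Z|-1)·d_λ² ≤ d_λ m_λ = 19` for the two non-trivial linear characters of `SL₂(𝔽₃)`),
previously "computation"; the landed cusp-form wall `subfieldCell_nine_wall` (gen 4) gives `21`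
because its real form `λ + λ̄` spans two layers.  Together with `subfieldCell_nine_rowTwo`
(`|Y| ≥ 2 ⇒ |Z| ≤ 17`, file V) the Lean-certified region at `q = 3` is now
`|Z| ≤ min(17, 20 - |Y|)` for `|Y| ≥ 2` (`|Z| ≤ 19` for `|Y| = 1`).

## Proof

In the standard model (`isSep_wall`): the relative count `relativeCount_le` (engine of
`CuspFormWall`) with the complex weight `e(h) = 2λ̄(h) = σ(cval (kexp h))`; its twisted averages
`T_e f (g) = Σ_h e(h) f(φ(h) g)` of frame functions are exactly the `Θ_g(cf)` of file II, so by the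
compression identity `two_Theta` they lie in the image of the 20 coordinate functions
`g ↦ w_g(i)`, which satisfy the one relation `Σ_i w_g(i) = 0` (`pairL_one_w`): dimension `≤ 19`.
General `(k, K, φ)`: `isSep_transport` (file V, via `embedding_conj`, file IV).
-/

set_option linter.dupNamespace false

namespace Summit.MatrixMultiplication.MatrixMultiplication.Theorems.GradedDesignFamily.Negative.SubfieldNine

open Matrix Module


/-- The standard embedding `mapGL : SL₂(𝔽₃) →* GL₂(𝔽₉)` is injective. -/
theorem mapGL_injective :
    Function.Injective (Matrix.SpecialLinearGroup.mapGL K : SL3 →* GL (Fin 2) K) := by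
  intro g g' h
  have h' := congrArg (fun u : GL (Fin 2) K => (u : Mat)) h
  simp only [Matrix.SpecialLinearGroup.mapGL_coe_matrix] at h'
  exact Subtype.ext (Matrix.map_injective QuadraticAlgebra.algebraMap_injective h')

/-- The linear map `E ↦ (g ↦ Σ_i w_g(i) E_i)` from dual vectors to functions on `GL₂(𝔽₉)`. -/
noncomputable def Lw : (Idx → ℂ) →ₗ[ℂ] (GL (Fin 2) K → ℂ) where
  toFun E g := ∑ i, w (g : Mat) i * E i
  map_add' E E' := by
    funext g
    simp only [Pi.add_apply, mul_add, Finset.sum_add_distrib]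
  map_smul' c E := by
    funext g
    simp only [Pi.smul_apply, smul_eq_mul, RingHom.id_apply, Finset.mul_sum, mul_left_comm]

/-- Unfolding `Lw`. -/
theorem Lw_apply (E : Idx → ℂ) (g : GL (Fin 2) K) : Lw E g = ∑ i, w (g : Mat) i * E i := rfl

/-- `rank Lw ≤ 19`: the constant vector is in the kernel (`Σ_i w_g(i) = 0`). -/
theorem finrank_range_Lw_le : finrank ℂ (LinearMap.range Lw) ≤ 19 := by
  have hker : (fun _ : Idx => (1 : ℂ)) ∈ LinearMap.ker Lw := by
    rw [LinearMap.mem_ker]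
    funext g
    rw [Lw_apply, Pi.zero_apply]
    exact pairL_one_w g
  have hne : (fun _ : Idx => (1 : ℂ)) ≠ 0 := by
    intro h
    have := congrFun h ((0 : Fin 10), (0 : Fin 2))
    simp at this
  have h1 : finrank ℂ (ℂ ∙ fun _ : Idx => (1 : ℂ)) = 1 := finrank_span_singleton hne
  have h2 : (ℂ ∙ fun _ : Idx => (1 : ℂ)) ≤ LinearMap.ker Lw :=
    (Submodule.span_singleton_le_iff_mem _ _).2 hker
  have h3 := Submodule.finrank_mono h2
  have h4 := LinearMap.finrank_range_add_finrank_ker Lw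
  rw [finrank_V] at h4
  omega

/-- **The exact counting wall in the standard model: `|Y| + |Z| ≤ 20`.**  The `λ`-isotypic part
of the frame span has dimension `≤ 19` (compression identity `two_Theta` + the hyperplane
relation `pairL_one_w`), and the relative count (`relativeCount_le`) with the weight
`h ↦ 2λ̄(h)` gives `(|Y| + |Z| - 1)·1 ≤ 19`. -/
theorem isSep_wall (Y Z : Finset (GL (Fin 2) K)) (hsep : IsSep Y Z) (hY : Y.Nonempty)
    (hZ : Z.Nonempty) : Y.card + Z.card ≤ 20 := by
  classical
  let φ : SL3 →* GL (Fin 2) K := Matrix.SpecialLinearGroup.mapGL K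
  have hφ : Function.Injective φ := mapGL_injective
  -- the host space `F₁(K)` (frame span), right-invariant, and the separators in packing form
  set FS := Submodule.span ℂ {f : Matrix.GeneralLinearGroup (Fin 2) K → ℂ |
      ∃ c : (Fin 2 → K) → (Fin 2 → K) → ℂ, f = fun g : Matrix.GeneralLinearGroup (Fin 2) K =>
        ∑ u : Fin 2 → K, c u ((g : Matrix (Fin 2) (Fin 2) K).mulVec u)} with hFS
  have hr : ∀ f ∈ FS, ∀ h : Matrix.GeneralLinearGroup (Fin 2) K, (fun g => f (g * h)) ∈ FS :=
    fun f hf h => by simpa only [one_mul] using SubfieldCell.frameSpan_biInv K f hf 1 h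
  have hsepX := SubfieldCell.frameSeparated_image φ hφ Y Z hsep
  have hsep' : ∀ x₀ ∈ Finset.univ.image φ, ∀ z₀ ∈ Z, ∃ f ∈ FS,
      ∀ x ∈ Finset.univ.image φ, ∀ y ∈ Y, ∀ y' ∈ Y, ∀ z ∈ Z,
        (x = x₀ ∧ y = y' ∧ z = z₀ → f (x⁻¹ * y * y'⁻¹ * z) = 1) ∧
        (¬ (x = x₀ ∧ y = y' ∧ z = z₀) → f (x⁻¹ * y * y'⁻¹ * z) = 0) := by
    intro x₀ hx₀ z₀ hz₀
    obtain ⟨cf, hcf⟩ := hsepX x₀ hx₀ z₀ hz₀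
    refine ⟨fun g => ∑ u : Fin 2 → K, cf u ((g : Matrix (Fin 2) (Fin 2) K).mulVec u),
      Submodule.subset_span ⟨cf, rfl⟩, fun x hx y hy y' hy' z hz => ⟨fun h => ?_, fun h => ?_⟩⟩
    · exact (hcf x hx y hy y' hy' z hz).trans (if_pos h)
    · exact (hcf x hx y hy y' hy' z hz).trans (if_neg h)
  -- the weight `e(h) = 2λ̄(h) = σ(cval (kexp h))` and the relative count
  let e : SL3 → ℂ := fun t => σ (cval (kexp t))
  have N := relativeCount_le φ hφ FS hr Y Z hY hZ hsep' e
  set R : (SL3 → ℂ) →ₗ[ℂ] (SL3 → ℂ) :=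
    ∑ t : SL3, e t • LinearMap.funLeft ℂ ℂ fun h : SL3 => t * h with hR_def
  have hR : ∀ (u : SL3 → ℂ) (h : SL3), R u h = ∑ t, e t * u (t * h) := by
    intro u h
    simp only [hR_def, LinearMap.coe_sum, Finset.sum_apply, LinearMap.smul_apply,
      LinearMap.funLeft_apply, Pi.smul_apply, smul_eq_mul]
  -- `r ≥ 1`: `R δ₁ 1 = e 1 = 2 ≠ 0`
  have he1 : e 1 = 2 := by
    show σ (cval (kexp 1)) = 2
    rw [kexp_one]
    exact σ_two
  have hr_pos : 0 < finrank ℂ (LinearMap.range R) := by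
    have hne : R (Pi.single 1 1) ≠ 0 := by
      intro h0
      have h1 : R (Pi.single 1 1) 1 = e 1 := by
        rw [hR]
        simp only [Pi.single_apply, mul_one]
        simp
      rw [h0, Pi.zero_apply, he1] at h1
      norm_num at h1
    have h1 : finrank ℂ (ℂ ∙ R (Pi.single 1 1)) = 1 := finrank_span_singleton hne
    have h2 : (ℂ ∙ R (Pi.single 1 1)) ≤ LinearMap.range R :=
      (Submodule.span_singleton_le_iff_mem _ _).2 (LinearMap.mem_range_self R _)
    have h3 := Submodule.finrank_mono h2
    omega
  -- `span T_e(F₁) ≤ range Lw` by the compression identity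
  have hle : Submodule.span ℂ ((fun f : Matrix.GeneralLinearGroup (Fin 2) K → ℂ =>
      fun g : Matrix.GeneralLinearGroup (Fin 2) K => ∑ t : SL3, e t * f (φ t * g)) ''
        (FS : Set (Matrix.GeneralLinearGroup (Fin 2) K → ℂ))) ≤ LinearMap.range Lw := by
    rw [Submodule.span_le]
    rintro _ ⟨f, hf, rfl⟩
    obtain ⟨c, hc⟩ := SubfieldCell.exists_coeff_of_mem_frameSpan K hf
    refine LinearMap.mem_range.2 ⟨(2⁻¹ : ℂ) • Edual c, ?_⟩
    funext g
    have hT : (∑ t : SL3, e t * f (φ t * g)) = Theta (g : Mat) c := by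
      unfold Theta
      refine Finset.sum_congr rfl fun t _ => ?_
      rw [hc, phiM_eq, ← Units.val_mul]
    show Lw ((2⁻¹ : ℂ) • Edual c) g = ∑ t : SL3, e t * f (φ t * g)
    rw [hT, map_smul, Pi.smul_apply, smul_eq_mul, Lw_apply, ← two_Theta]
    ring
  have hspan := (Submodule.finrank_mono hle).trans finrank_range_Lw_le
  -- assemble
  have key := N.trans hspan
  have := Nat.le_mul_of_pos_right (Y.card + Z.card - 1) hr_pos
  omega


/-- **The exact counting wall of the `q = 3` subfield cell, for EVERY `(k, K, φ)`:** for fields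
`k, K` with `|k| = 3`, `|K| = |k|²`, every injective `φ : SL₂(k) →* GL₂(K)` and all nonempty
finite `Y, Z ⊆ GL₂(K)` satisfying S3's separation clause verbatim, `|Y| + |Z| ≤ 20`
(the gen-4 Lean wall `subfieldCell_nine_wall` gave `21`; `20 = m_λ + 1` is the value of the
character computation, SUBFIELD.md §2).  Finite-cell theorem, NOT summit progress. -/
theorem subfieldCell_nine_wall_twenty {k K' : Type} [Field k] [Fintype k] [DecidableEq k]
    [Field K'] [Fintype K'] [DecidableEq K'] (hk : Fintype.card k = 3)
    (φ : Matrix.SpecialLinearGroup (Fin 2) k →* Matrix.GeneralLinearGroup (Fin 2) K')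
    (hφ : Function.Injective φ) (hK : Fintype.card K' = Fintype.card k ^ 2)
    (Y Z : Finset (Matrix.GeneralLinearGroup (Fin 2) K')) (hY : Y.Nonempty) (hZ : Z.Nonempty)
    (hsep : ∀ z₀ ∈ Z, ∃ cf : (Fin 2 → K') → (Fin 2 → K') → ℂ,
      ∀ a : Matrix.SpecialLinearGroup (Fin 2) k, ∀ y ∈ Y, ∀ y' ∈ Y, ∀ z ∈ Z,
        (∑ u : Fin 2 → K', cf u (((φ a * y * y'⁻¹ * z : Matrix.GeneralLinearGroup (Fin 2) K') :
            Matrix (Fin 2) (Fin 2) K').mulVec u)) =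
          if a = 1 ∧ y = y' ∧ z = z₀ then 1 else 0) :
    Y.card + Z.card ≤ 20 := by
  obtain ⟨Y', Z', hY', hZ', hsep'⟩ := isSep_transport hk φ hφ hK Y Z hsep
  have h1 : Y'.Nonempty := by rw [← Finset.card_pos, hY']; exact hY.card_pos
  have h2 : Z'.Nonempty := by rw [← Finset.card_pos, hZ']; exact hZ.card_pos
  have := isSep_wall Y' Z' hsep' h1 h2
  omega

/-- Corollary: `|Y|·|Z| ≤ 100`, i.e. design volume `|SL₂(𝔽₃)|·|Y|·|Z| ≤ 2400` (gen 4: `2640`). -/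
theorem subfieldCell_nine_area_le {k K' : Type} [Field k] [Fintype k] [DecidableEq k]
    [Field K'] [Fintype K'] [DecidableEq K'] (hk : Fintype.card k = 3)
    (φ : Matrix.SpecialLinearGroup (Fin 2) k →* Matrix.GeneralLinearGroup (Fin 2) K')
    (hφ : Function.Injective φ) (hK : Fintype.card K' = Fintype.card k ^ 2)
    (Y Z : Finset (Matrix.GeneralLinearGroup (Fin 2) K'))
    (hsep : ∀ z₀ ∈ Z, ∃ cf : (Fin 2 → K') → (Fin 2 → K') → ℂ,
      ∀ a : Matrix.SpecialLinearGroup (Fin 2) k, ∀ y ∈ Y, ∀ y' ∈ Y, ∀ z ∈ Z,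
        (∑ u : Fin 2 → K', cf u (((φ a * y * y'⁻¹ * z : Matrix.GeneralLinearGroup (Fin 2) K') :
            Matrix (Fin 2) (Fin 2) K').mulVec u)) =
          if a = 1 ∧ y = y' ∧ z = z₀ then 1 else 0) :
    Y.card * Z.card ≤ 100 := by
  rcases Y.eq_empty_or_nonempty with rfl | hY
  · simp
  rcases Z.eq_empty_or_nonempty with rfl | hZ
  · simp
  have h := subfieldCell_nine_wall_twenty hk φ hφ hK Y Z hY hZ hsep
  have h' : (Y.card : ℤ) + Z.card ≤ 20 := by exact_mod_cast h
  have : (Y.card : ℤ) * Z.card ≤ 100 := by nlinarith [sq_nonneg ((Y.card : ℤ) - Z.card)]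
  exact_mod_cast this

end Summit.MatrixMultiplication.MatrixMultiplication.Theorems.GradedDesignFamily.Negative.SubfieldNine
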